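import Summits.BirchSwinnertonDyer.BirchSwinnertonDyer.Theorems.PrintX10bCornerOfKolyvaginSystemLeaf
import Summits.BirchSwinnertonDyer.BirchSwinnertonDyer.Theorems.PrintX10bMuPartOfPrintKSAnyClassNumberClosed
import HarnessLib

/-!
# Row 10's A-side from THREE print leaves — Howard Thm. 1.6.1 (F-161), CGLS Thm. 4.1.1 in Kolyvagin-system form (F-411),
# CGS Thm. 6.5.2 (`hCGS`) — with NO class-number case split on the odd-`d_K` X10b frames: Mastella–Zerman 2026 Cor. 4.6
# (`hMZ`) leaves row 10's trust base too; displays `wallCornerX10b_of_sixLeaves` / `bsdpOnClassX10b_of_sixLeaves`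

Cell `pub/bsd-print-x9`, seat `bsd-line-x9-p1` (LEAD g7) at the pen's request (plan g14, 2026-08-29T04:26:36Z: «X10b twin needs
the three-leaf `… → HowardContainmentLightFrameX10bPinned`»); the X10b twin of this seat's row-9 file
`Theorems/PrintX9HowardContainmentPinnedOfSixLeaves.lean` (p695713). THEOREMS ONLY; helper (`--supports`, no `closes` change).

WHY. x10b-p2 LEAD g11's `PrintX10bOfKSLeaf.pinnedContainment_oddDisc_at_of_howard_kolyvaginSystem_mz_cgs` (p690942) splits on
`3 ∣ h_K`: the `3 ∣ h_K` branch runs the Kolyvagin-system μ-chain through the route-free core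
`HeegnerStabilizedOfKSLeaf.exists_coherentPair_isTorsion_muIneq_of_howard_kolyvaginSystem` (p689159), the `3 ∤ h_K` branch cites
MZ26 Cor. 4.6. By bsd-line-x10b-p1 LEAD g11's FINDING «hhK-IDLE» and the landed any-class-number chain (K1 p690817, K2a–c
p692659 / p692809 / p694699, K3 p691788, K3c p695083) the strengthened coherent-pair letter
`HeegnerMuPartKSAnyClassNumber.exists_coherentPair_isTorsion_muIneq_of_howard_kolyvaginSystem_anyClassNumber (h161 h411)` holds on
EVERY `Thm413Hypotheses` frame with (irr_ℚ), (irr_K), (Heeg_p), `p ∤ N`, the sharp tower and `[K[p]:K[1]] = p − 1` — no `p ∣ h_K`,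
no `¬CM`, no scalar-image input. So p690942 §1's `3 ∣ h_K` proof runs verbatim on every odd-`d_K` X10b frame; `hMZ`, `¬ Surj W 3`
and `¬ W.HasCM` are idle for the containment.

WHAT.
* `pinnedContainment_oddDisc_at_of_howard_kolyvaginSystem_cgs (hH hK hCGS)` — the pinned containment for a given `jbar` on an
  odd-`d_K` X10b Heegner frame with (irr_K), ANY class number, ANY Selmer corank.
* **`howardContainmentLightFrameX10bPinned_of_howard_kolyvaginSystem_cgs :
  HowardDVRKolyvaginBound → CGLSHeegnerKolyvaginSystem → CGSHowardDivisibilityPLocalized → HowardContainmentLightFrameX10bPinned`**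
  (item 27274 from THREE `closes` binders; for the pen's t3⁸: the X10b glue item
  `HowardDVRKolyvaginBound → CGLSHeegnerKolyvaginSystem → CGSHowardDivisibilityPLocalized → HowardContainmentLightFrameX10bPinned` closes
  at once by this theorem).
* **`wallCornerX10b_of_sixLeaves` / `bsdpOnClassX10b_of_sixLeaves (hH hK hCGS hPT hHP hP)`** — the row-10 corner
  `WAllCornerX10b` and the leaf `X10.BSDpOnClassX10b` from SIX cite-only binders {F-161, F-411, CGS 6.5.2,
  `PinnedTransferPrintFacts`, `HeegnerPrintFactsX10b`, `PrintFactsX10b`} through the closed doors (x10b-p2 LEAD g11's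
  `PrintX10bCornerOfKSLeaf` displays p693320 = SEVEN, minus `hMZ`).
CONDITIONAL on the leaves named; no item is closed by this file as typed; no route verb is implied. «beyond-print theorem»: no.
No summit statement is proved; BSD is NOT proved by any of this.

References: [Howard2004HeegnerKolyvagin] Thm. 1.6.1, proof of Thm. 2.2.10, Thm. B; [CastellaGrossiLeeSkinner2022] Thm. 4.1.1, Rem. 4.1.4;
[CastellaGrossiSkinner2025] Thm. 6.5.2; [PerrinRiou1987BSMF] §3.4 Prop. 10; [Washington1997] §13.2.
-/

set_option linter.dupNamespace false
set_option autoImplicit false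

noncomputable section

open scoped Classical Pointwise
open Literature Literature.NumberTheory.EllipticCurves WeierstrassCurve
  Literature.NumberTheory.EllipticCurves.ModularForms
  Literature.NumberTheory.EllipticCurves.CastellaGrossiLeeSkinner2022
  Literature.NumberTheory.GaloisCohomology.Howard2004
open Literature.NumberTheory.EllipticCurves.Rank1Residual (ClassX10 Surj)
open Summit.BirchSwinnertonDyer.BirchSwinnertonDyer.Theses.PrintX10b
  (HowardDVRKolyvaginBound CGLSHeegnerKolyvaginSystem CGSHowardDivisibilityPLocalized
    HowardContainmentLightFrameX10bPinned PinnedTransferPrintFacts HeegnerPrintFactsX10b PrintFactsX10b)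
open Summit.BirchSwinnertonDyer.BirchSwinnertonDyer.Theorems

namespace Summit.BirchSwinnertonDyer.BirchSwinnertonDyer.Theorems.PrintX10bOfKSLeaf

/-! ## §1 The pinned containment for a GIVEN `jbar` on an odd-`d_K` X10b frame, from `hH hK hCGS` — no class-number split -/

/-- **The PINNED Howard containment on an odd-`d_K` X10b Heegner frame with (irr_K), for a given `jbar`, from Howard 2004 Thm. 1.6.1
(`HowardDVRKolyvaginBound`), CGLS 2022 Thm. 4.1.1 in Kolyvagin-system form (`CGLSHeegnerKolyvaginSystem`) and CGS 2025 Thm. 6.5.2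
(`CGSHowardDivisibilityPLocalized`) ONLY**: `∃ D F X, F.Dt = Dt ∧ I(ℋ_∞(F))² ⊆ char_Λ(X_{Λ-tors})` — ANY class number (no case
split), ANY Selmer corank.  The any-class-number coherent-pair letter (torsion and the μ-inequality DERIVED from `Λ`-rank one),
`Λ`-rank one / finiteness / `(p^m)·I(Λκ_∞(C))² ⊆ char` from Thm. 6.5.2, the μ-promotion, and `I(ℋ_F) ≤ I(Λκ_C)` along the envelope;
the tower input is the THEOREM `anticyclotomicTowerSharp`.  p690942 §1 verbatim with its `3 ∣ h_K` hypothesis, `¬CM` and the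
scalar image no longer fed. [cite: Howard2004HeegnerKolyvagin, Thm. 1.6.1 and proof of Thm. 2.2.10]
[cite: CastellaGrossiLeeSkinner2022, Thm. 4.1.1, Rem. 4.1.4] [cite: CastellaGrossiSkinner2025, Thm. 6.5.2] [cite: Washington1997, §13.2] -/
theorem pinnedContainment_oddDisc_at_of_howard_kolyvaginSystem_cgs
    (hH : HowardDVRKolyvaginBound) (hK : CGLSHeegnerKolyvaginSystem) (hCGS : CGSHowardDivisibilityPLocalized)
    {W : WeierstrassCurve ℚ} [W.IsElliptic] [W.IsGloballyMinimal] {p : ℕ} [Fact p.Prime]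
    [NeZero (W.conductorNorm ℤ)] {K : Type} [Field K] [NumberField K]
    (hX : ClassX10 W p) (hKq : IsImaginaryQuadratic K)
    (hodd : Odd (NumberField.discr K)) (h3 : NumberField.discr K ≠ -3)
    (hHN : SatisfiesHeegnerHypothesis (W.conductorNorm ℤ) K) (hHp : SatisfiesHeegnerHypothesis p K)
    (hirr : (W.baseChange K).HasIrreducibleModPGaloisRep p)
    {κ : ZpExtension K p} (hκ : κ.IsAnticyclotomic) {γ : Field.absoluteGaloisGroup K} (hγ : κ.IsTopGenerator γ)
    (Dt : ModularParametrizationData W (W.conductorNorm ℤ))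
    (H : HeegnerDatum (W.conductorNorm ℤ) (NumberField.discr K)) (jbar : AlgebraicClosure K →+* ℂ) :
    ∃ (D : (W.baseChange K).LambdaAdicSelmerData κ γ) (F : HeegnerFamily (W.conductorNorm ℤ) W K κ jbar)
      (X : (W.baseChange K).SelmerDualData κ γ),
      F.Dt = Dt ∧ heegnerCharIdeal D F ^ 2 ≤
        Module.charIdeal (IwasawaAlgebra p) (Submodule.torsion (IwasawaAlgebra p) X.X) := by
  have hp : p.Prime := Fact.out
  obtain ⟨D⟩ := LambdaAdicSelmerDataExists.nonempty_lambdaAdicSelmerData (W.baseChange K) p κ hγ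
  obtain ⟨X⟩ := (W.baseChange K).nonempty_selmerDualData_holds κ γ hγ
  have hyp := Summit.BirchSwinnertonDyer.BirchSwinnertonDyer.Rank1Residual.X10.thm413Hypotheses_of_classX10
    hX hKq h3 hHN hHp hodd hκ hγ
  have hirrQ : W.HasIrreducibleModPGaloisRep p := by
    obtain ⟨rfl, -⟩ := id hX
    exact hX.irr
  have hTw1 : ∀ k : ℕ, ringClassSubgroup K (p ^ (k + 1)) jbar ≤ κ.layerSubgroup k :=
    fun k ↦ anticyclotomicTowerSharp K p (hp.odd_of_ne_two hX.ne_two) hKq κ hκ jbar k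
  -- the two Howard-side leaves, by name
  have h161 : thm161_dvrKolyvaginBound := hH
  have hKS : thm411_exists_kolyvaginSystem_one_ne_zero := hK
  -- the any-class-number coherent-pair letter at `(Dt, H.β, D, X)`: pair, envelopes, torsion and μ from rank one
  obtain ⟨C, F, -, hFDt, -, -, hle, ⟨g, hg, hrev⟩, htf, hμC⟩ :=
    HeegnerMuPartKSAnyClassNumber.exists_coherentPair_isTorsion_muIneq_of_howard_kolyvaginSystem_anyClassNumber h161 hKS
      (W.conductorNorm ℤ) W K p κ γ jbar hyp hirrQ hirr hHp hX.not_dvd_conductorNorm hTw1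
      (card_ringClassGalOver_prime_one_of_frame hKq hodd h3 hp hHp jbar) Dt H.β H.dvd_sq_sub D X
  -- CGS Thm. 6.5.2 BY NAME at `(D, C, X)`: finiteness, `Λ`-rank one, the p-localized bound in C-currency
  have h652 : CastellaGrossiSkinner2025.thm652_stabilized_rankOne_charIdeal_torsion_dvd_pLocalized.{0} := hCGS
  obtain ⟨⟨hfinS, hS1⟩, hfinX, -⟩ := h652 (W.conductorNorm ℤ) W K p κ γ jbar hyp D C X
  haveI := hfinS
  haveI := hfinX
  obtain ⟨hfree, htorC⟩ := htf hfinS hS1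
  haveI := hfree
  obtain ⟨m, hm⟩ := CastellaGrossiSkinner2025.span_pow_mul_sq_le_charIdeal_torsion_of_thm652_stabilized h652
    hyp D C X
  -- the μ-inequality at `C` (derived from rank one) promotes the p-localized bound
  haveI : IsNoetherian (IwasawaAlgebra p) X.X := isNoetherian_of_isNoetherianRing_of_finite _ _
  haveI : Module.Finite (IwasawaAlgebra p) (Submodule.torsion (IwasawaAlgebra p) X.X) := inferInstance
  haveI : Module.Finite (IwasawaAlgebra p) (D.S ⧸ stabilizedHeegnerModule D C) := inferInstance
  have hsqC : stabilizedHeegnerCharIdeal D C ^ 2 ≤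
      Module.charIdeal (IwasawaAlgebra p) (Submodule.torsion (IwasawaAlgebra p) X.X) := by
    rw [stabilizedHeegnerCharIdeal_def] at hm ⊢
    exact IwasawaAlgebra.sq_charIdeal_le_charIdeal_of_span_p_pow_mul_le_of_lengthAt_le_two_mul
      (Submodule.torsion_isTorsion (R := IwasawaAlgebra p) (M := X.X)) htorC (hμC hfinS hfinX hS1) hm
  -- torsion of `𝔖/ℋ_F` from the reverse inclusion, then `I(ℋ_F) ≤ I(Λκ_C)` from the forward inclusion
  have htor : Module.IsTorsion (IwasawaAlgebra p) (D.S ⧸ heegnerModule D F) :=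
    isTorsion_quotient_heegnerModule_of_smul_stabilizedHeegnerModule_le D F C hg hrev htorC
  have hIF : heegnerCharIdeal D F ≤ stabilizedHeegnerCharIdeal D C :=
    heegnerCharIdeal_le_stabilizedHeegnerCharIdeal_of_le D F C htor hle
  exact ⟨D, F, X, hFDt, (Ideal.pow_right_mono hIF 2).trans hsqC⟩

/-! ## §2 The light pinned containment (27274) from THREE `closes` binders -/

/-- **`HowardContainmentLightFrameX10bPinned` (stmt-BirchSwinnertonDyer-27274) from THREE `closes` binders — `hH`, `hK`, `hCGS`**
(no `MastellaZermanHowardDivisibility`, no `CGLSHeegnerClassNonvanishing`, no tower binder, no `CoatesGreenbergKummerImage`, no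
μ-letter; the frame's `¬ Surj W 3`, `¬ W.HasCM` and the light binders `hc`, `hrk`, `hfin` are idle): §1 with
`jbar := IsAlgClosed.lift` along `ιC`. [cite: Howard2004HeegnerKolyvagin, Thm. 1.6.1] [cite: CastellaGrossiLeeSkinner2022, Thm. 4.1.1]
[cite: CastellaGrossiSkinner2025, Thm. 6.5.2] -/
theorem howardContainmentLightFrameX10bPinned_of_howard_kolyvaginSystem_cgs
    (hH : HowardDVRKolyvaginBound) (hK : CGLSHeegnerKolyvaginSystem) (hCGS : CGSHowardDivisibilityPLocalized) :
    HowardContainmentLightFrameX10bPinned := by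
  intro W _ _ p _ _ K _ _ hX _hns _hcm hKq hodd h3 hHN hHp hirr κ hκ γ hγ Dt H ιC _hc _hrk _hfin
  letI : Algebra K ℂ := ιC.toAlgebra
  let jbar : AlgebraicClosure K →+* ℂ :=
    (IsAlgClosed.lift (R := K) (M := ℂ) (S := AlgebraicClosure K)).toRingHom
  obtain ⟨D, F, X, hFDt, h⟩ := pinnedContainment_oddDisc_at_of_howard_kolyvaginSystem_cgs hH hK hCGS hX hKq hodd h3 hHN
    hHp hirr hκ hγ Dt H jbar
  exact ⟨jbar, D, F, X, hFDt, h⟩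

/-! ## §3 Displays: the row-10 corner and the X10b leaf from SIX cite-only binders -/

/-- **DISPLAY — the W-ALL row-10 corner `WAllCornerX10b` from SIX cite-only binders**: Howard 2004 Thm. 1.6.1 (`hH`), CGLS 2022
Thm. 4.1.1 in Kolyvagin-system form (`hK`), CGS 2025 Thm. 6.5.2 (`hCGS`), `PinnedTransferPrintFacts`, `HeegnerPrintFactsX10b`,
`PrintFactsX10b` — through the light assembly (`PrintX10bAssemblyLightTwinsX10b.assemblyLightTwinsX10b_proof`), the T-G′ door
(`PrintX10bPinned.twoSidedLinkAnyClassNumberX10bPinnedOfPrint_holds`), the proved `AnalyticMuZeroX10b_of`, and §2 for the A-side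
(x10b-p2 LEAD g11's `PrintX10bCornerOfKSLeaf.wallCornerX10b_of_kolyvaginSystemLeaf_of_printBinders` p693320 = SEVEN, minus `hMZ`).
CONDITIONAL on the six hypotheses; a display, not a closure. [cite: Howard2004HeegnerKolyvagin, Thm. 1.6.1]
[cite: CastellaGrossiLeeSkinner2022, Thm. 4.1.1] [cite: CastellaGrossiSkinner2025, Thm. 6.5.2] -/
theorem wallCornerX10b_of_sixLeaves
    (hH : HowardDVRKolyvaginBound) (hK : CGLSHeegnerKolyvaginSystem) (hCGS : CGSHowardDivisibilityPLocalized)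
    (hPT : PinnedTransferPrintFacts) (hHP : HeegnerPrintFactsX10b) (hP : PrintFactsX10b) :
    Summit.BirchSwinnertonDyer.WAllCornerX10b :=
  Summit.BirchSwinnertonDyer.Rank1Residual.WAll.wallCornerX10b_of_bsdpOnClassX10b
    (PrintX10bAssemblyLightTwinsX10b.assemblyLightTwinsX10b_proof
      (howardContainmentLightFrameX10bPinned_of_howard_kolyvaginSystem_cgs hH hK hCGS)
      (PrintX10bPinned.twoSidedLinkAnyClassNumberX10bPinnedOfPrint_holds hPT hHP)
      hHP Summit.BirchSwinnertonDyer.BirchSwinnertonDyer.Cruxes.AnalyticMuZeroX10b.TheoremB.AnalyticMuZeroX10b_of hP)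

/-- **DISPLAY — the partition leaf `X10.BSDpOnClassX10b` from the same SIX cite-only binders** (through the light assembly).
[cite: Howard2004HeegnerKolyvagin, Thm. 1.6.1] [cite: CastellaGrossiLeeSkinner2022, Thm. 4.1.1] [cite: CastellaGrossiSkinner2025, Thm. 6.5.2] -/
theorem bsdpOnClassX10b_of_sixLeaves
    (hH : HowardDVRKolyvaginBound) (hK : CGLSHeegnerKolyvaginSystem) (hCGS : CGSHowardDivisibilityPLocalized)
    (hPT : PinnedTransferPrintFacts) (hHP : HeegnerPrintFactsX10b) (hP : PrintFactsX10b) :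
    Summit.BirchSwinnertonDyer.Rank1Residual.X10.BSDpOnClassX10b :=
  PrintX10bAssemblyLightTwinsX10b.assemblyLightTwinsX10b_proof
    (howardContainmentLightFrameX10bPinned_of_howard_kolyvaginSystem_cgs hH hK hCGS)
    (PrintX10bPinned.twoSidedLinkAnyClassNumberX10bPinnedOfPrint_holds hPT hHP)
    hHP Summit.BirchSwinnertonDyer.BirchSwinnertonDyer.Cruxes.AnalyticMuZeroX10b.TheoremB.AnalyticMuZeroX10b_of hP

end Summit.BirchSwinnertonDyer.BirchSwinnertonDyer.Theorems.PrintX10bOfKSLeaf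

end
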